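/-
Copyright (c) 2026. All rights reserved.
Released under Apache 2.0 license as described in the file LICENSE.
-/
import Mathlib.Combinatorics.SimpleGraph.Connectivity.Connected
import Mathlib.Data.Matrix.Basis
import Mathlib.GroupTheory.OrderOfElement
import Summits.ValiantsHypothesis.ValiantsHypothesis.Theorems.ShortCyclePatterns

/-!
# Relation graphs, dart matrices and the termination criterion of the isolation scheme

Stage S4a of the O-L2-14 isolation series (S1 `SuccinctCirculationHashing`, S2
`MinimumPerfectMatchingFace`, S3 `ShortCyclePatterns`).  For `G : α → β → Prop` the RELATION GRAPH
`relGraph G` is the bipartite simple graph on `α ⊕ β` with an edge `inl a — inr b` whenever `G a b`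
(for `α = β = Fin r` its perfect matchings are the `G`-admissible permutations).  The DART MATRIX
labelling `dartMat` sends the dart `inl a → inr b` to `+E_{ab}` and `inr b → inl a` to `-E_{ab}`; the
dart sum `walkSum dartMat c ∈ Matrix α β ℤ` of a closed walk is its signed incidence («circulation»)
matrix: zero row/column sums (flow conservation), support inside `G`, entries in `{-1, 0, 1}` along
trails, non-zero on non-trivial trails — the `hrow`/`hcol`/`hD` data of S2's `face_orthogonal` and
the height bound `|π μ| ≤ n` of S1's `exists_cktSize_circ_ne_zero`.

TERMINATION CRITERION (`perm_unique_of_forall_not_isCycle`): if `relGraph G` on `Fin r ⊕ Fin r` has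
no cycle then `G` admits at most one admissible permutation — for admissible `σ ≠ τ`, along a
non-trivial orbit `kᵢ = (σ⁻¹τ)ⁱ k₀` the `τ`-edges `inl kᵢ — inr τkᵢ = inr σkᵢ₊₁` and the `σ`-edges
`inr σkⱼ — inl kⱼ` (`0 < j <` first return time) connect `inl k₀` to `inr σk₀` avoiding the edge
`inl k₀ — inr σk₀`, which therefore lies on a cycle (`adj_and_reachable_delete_edges_iff_exists_cycle`);
this is the last round of the isolation scheme of [cite: FennerGurjarThierauf2016, Section 3].
Currency: kernel-certified helper for the W4 isolation road (stage S4a); closes no item; two data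
defs (`relGraph`, `dartMat`), no `def … : Prop`, no facts, no doors.
-/

set_option linter.dupNamespace false

namespace Summit.ValiantsHypothesis.ValiantsHypothesis.Theorems.RelationGraphCycles

open SimpleGraph Summit.ValiantsHypothesis.ValiantsHypothesis.Theorems.ShortCyclePatterns

variable {α β : Type*}

/-! ## §1 The relation graph -/

/-- The bipartite RELATION GRAPH of `G : α → β → Prop` on `α ⊕ β` (edges `inl a — inr b` for
`G a b`). [folklore] -/
def relGraph (G : α → β → Prop) : SimpleGraph (α ⊕ β) :=
  SimpleGraph.fromRel fun x y => ∃ a b, x = Sum.inl a ∧ y = Sum.inr b ∧ G a b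

/-- Adjacency in the relation graph. [folklore] -/
theorem relGraph_adj_iff {G : α → β → Prop} {x y : α ⊕ β} :
    (relGraph G).Adj x y ↔
      ∃ a b, G a b ∧ ((x = Sum.inl a ∧ y = Sum.inr b) ∨ (x = Sum.inr b ∧ y = Sum.inl a)) := by
  rw [relGraph, SimpleGraph.fromRel_adj]
  constructor
  · rintro ⟨-, ⟨a, b, rfl, rfl, h⟩ | ⟨a, b, rfl, rfl, h⟩⟩
    · exact ⟨a, b, h, Or.inl ⟨rfl, rfl⟩⟩
    · exact ⟨a, b, h, Or.inr ⟨rfl, rfl⟩⟩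
  · rintro ⟨a, b, h, ⟨rfl, rfl⟩ | ⟨rfl, rfl⟩⟩
    · exact ⟨Sum.inl_ne_inr, Or.inl ⟨a, b, rfl, rfl, h⟩⟩
    · exact ⟨Sum.inr_ne_inl, Or.inr ⟨a, b, rfl, rfl, h⟩⟩

/-- [folklore] -/
@[simp] theorem relGraph_adj_inl_inr (G : α → β → Prop) (a : α) (b : β) :
    (relGraph G).Adj (Sum.inl a) (Sum.inr b) ↔ G a b := by
  rw [relGraph_adj_iff]
  constructor
  · rintro ⟨a', b', h, ⟨ha, hb⟩ | ⟨ha, -⟩⟩ <;> cases ha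
    cases hb
    exact h
  · exact fun h => ⟨a, b, h, Or.inl ⟨rfl, rfl⟩⟩

/-- [folklore] -/
@[simp] theorem relGraph_adj_inr_inl (G : α → β → Prop) (a : α) (b : β) :
    (relGraph G).Adj (Sum.inr b) (Sum.inl a) ↔ G a b := by
  rw [SimpleGraph.adj_comm]
  exact relGraph_adj_inl_inr G a b

/-- [folklore] -/
@[simp] theorem relGraph_not_adj_inl_inl (G : α → β → Prop) (a a' : α) :
    ¬ (relGraph G).Adj (Sum.inl a) (Sum.inl a') := by
  rw [relGraph_adj_iff]
  rintro ⟨a₁, b₁, -, ⟨-, h⟩ | ⟨h, -⟩⟩ <;> cases h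

/-- [folklore] -/
@[simp] theorem relGraph_not_adj_inr_inr (G : α → β → Prop) (b b' : β) :
    ¬ (relGraph G).Adj (Sum.inr b) (Sum.inr b') := by
  rw [relGraph_adj_iff]
  rintro ⟨a₁, b₁, -, ⟨h, -⟩ | ⟨-, h⟩⟩ <;> cases h

/-- [folklore] -/
theorem relGraph_mono {G G' : α → β → Prop} (h : ∀ a b, G a b → G' a b) :
    relGraph G ≤ relGraph G' := by
  intro x y hxy
  rw [relGraph_adj_iff] at hxy ⊢
  obtain ⟨a, b, hab, hor⟩ := hxy
  exact ⟨a, b, h a b hab, hor⟩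

/-! ## §2 The dart matrix labelling -/

section DartMat

variable [DecidableEq α] [DecidableEq β]

/-- The signed biadjacency («dart matrix») labelling: the dart `inl a → inr b` contributes `+E_{ab}`,
the dart `inr b → inl a` contributes `-E_{ab}`. [cite: FennerGurjarThierauf2016, Section 3] -/
def dartMat : α ⊕ β → α ⊕ β → Matrix α β ℤ
  | Sum.inl a, Sum.inr b => Matrix.single a b 1
  | Sum.inr b, Sum.inl a => -Matrix.single a b 1
  | _, _ => 0

/-- [folklore] -/
@[simp] theorem dartMat_inl_inr (a : α) (b : β) :
    dartMat (Sum.inl a) (Sum.inr b) = Matrix.single a b (1 : ℤ) := rfl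

/-- [folklore] -/
@[simp] theorem dartMat_inr_inl (a : α) (b : β) :
    dartMat (Sum.inr b) (Sum.inl a) = -Matrix.single a b (1 : ℤ) := rfl

/-- What a single dart of the relation graph contributes: an entry `±1` at a position in `G`, on
the edge of the dart. [folklore] -/
theorem rel_of_dartMat_apply_ne_zero {G : α → β → Prop} {x y : α ⊕ β}
    (hxy : (relGraph G).Adj x y) {a : α} {b : β} (h : dartMat x y a b ≠ 0) :
    G a b ∧ s(x, y) = s(Sum.inl a, Sum.inr b) ∧ (dartMat x y a b = 1 ∨ dartMat x y a b = -1) := by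
  obtain ⟨a', b', hG, ⟨rfl, rfl⟩ | ⟨rfl, rfl⟩⟩ := relGraph_adj_iff.1 hxy
  · by_cases hab : a' = a ∧ b' = b
    · obtain ⟨rfl, rfl⟩ := hab
      exact ⟨hG, rfl, Or.inl (by simp)⟩
    · exact absurd (by simp [hab]) h
  · by_cases hab : a' = a ∧ b' = b
    · obtain ⟨rfl, rfl⟩ := hab
      exact ⟨hG, Sym2.eq_swap, Or.inr (by simp)⟩
    · exact absurd (by simp [hab]) h

/-! ## §3 Dart matrices of closed walks and trails -/

/-- Flow conservation with the reversed orientation (net number of darts ENTERING `x`). [folklore] -/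
theorem walkSum_flow' {V : Type*} [DecidableEq V] {H : SimpleGraph V} (x : V) {u v : V}
    (p : H.Walk u v) :
    walkSum (fun a b => (if b = x then (1 : ℤ) else 0) - (if a = x then 1 else 0)) p
      = (if v = x then (1 : ℤ) else 0) - (if u = x then 1 else 0) := by
  induction p with
  | nil => simp
  | cons h p ih => rw [walkSum_cons, ih, add_comm, sub_add_sub_cancel]

/-- The dart matrix of a CLOSED walk has zero row sums. [folklore] -/
theorem sum_walkSum_dartMat_row [Fintype β] {G : α → β → Prop} {u : α ⊕ β}
    (c : (relGraph G).Walk u u) (a : α) : ∑ b, walkSum dartMat c a b = 0 := by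
  let φ : Matrix α β ℤ →+ ℤ := AddMonoidHom.mk' (fun D => ∑ b, D a b) (fun D E => by
    simp only [Matrix.add_apply]
    exact Finset.sum_add_distrib)
  have hφ : ∀ D, φ D = ∑ b, D a b := fun D => rfl
  have h2 : ∀ x y, (relGraph G).Adj x y →
      φ (dartMat x y) = (if x = Sum.inl a then (1 : ℤ) else 0) - (if y = Sum.inl a then 1 else 0) := by
    intro x y hxy
    obtain ⟨a', b', -, ⟨rfl, rfl⟩ | ⟨rfl, rfl⟩⟩ := relGraph_adj_iff.1 hxy
    · rw [hφ]
      by_cases h : a' = a <;> simp [Matrix.single_apply, h]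
    · rw [hφ]
      by_cases h : a' = a <;> simp [Matrix.single_apply, h]
  have h3 : φ (walkSum dartMat c) = 0 := by
    rw [map_walkSum, walkSum_congr h2, walkSum_flow, sub_self]
  exact (hφ _).symm.trans h3

/-- The dart matrix of a CLOSED walk has zero column sums. [folklore] -/
theorem sum_walkSum_dartMat_col [Fintype α] {G : α → β → Prop} {u : α ⊕ β}
    (c : (relGraph G).Walk u u) (b : β) : ∑ a, walkSum dartMat c a b = 0 := by
  let φ : Matrix α β ℤ →+ ℤ := AddMonoidHom.mk' (fun D => ∑ a, D a b) (fun D E => by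
    simp only [Matrix.add_apply]
    exact Finset.sum_add_distrib)
  have hφ : ∀ D, φ D = ∑ a, D a b := fun D => rfl
  have h2 : ∀ x y, (relGraph G).Adj x y →
      φ (dartMat x y) = (if y = Sum.inr b then (1 : ℤ) else 0) - (if x = Sum.inr b then 1 else 0) := by
    intro x y hxy
    obtain ⟨a', b', -, ⟨rfl, rfl⟩ | ⟨rfl, rfl⟩⟩ := relGraph_adj_iff.1 hxy
    · rw [hφ]
      by_cases h : b' = b <;> simp [Matrix.single_apply, h]
    · rw [hφ]
      by_cases h : b' = b <;> simp [Matrix.single_apply, h]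
  have h3 : φ (walkSum dartMat c) = 0 := by
    rw [map_walkSum, walkSum_congr h2, walkSum_flow', sub_self]
  exact (hφ _).symm.trans h3

/-- The dart matrix of a walk in `relGraph G` is supported on `G`. [folklore] -/
theorem rel_of_walkSum_dartMat_ne_zero {G : α → β → Prop} {u v : α ⊕ β}
    (p : (relGraph G).Walk u v) {a : α} {b : β} (h : walkSum dartMat p a b ≠ 0) : G a b := by
  obtain ⟨d, -, hd⟩ := exists_dart_of_map_walkSum_ne_zero (Matrix.entryAddMonoidHom ℤ a b) dartMat
    (p := p) (by simpa using h)
  exact (rel_of_dartMat_apply_ne_zero d.adj (by simpa using hd)).1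

/-- The dart matrix of a TRAIL has entries in `{-1, 0, 1}`. [folklore] -/
theorem natAbs_walkSum_dartMat_le {G : α → β → Prop} {u v : α ⊕ β}
    {p : (relGraph G).Walk u v} (hp : p.IsTrail) (a : α) (b : β) :
    (walkSum dartMat p a b).natAbs ≤ 1 := by
  have he : ∀ x y, (relGraph G).Adj x y → Matrix.entryAddMonoidHom ℤ a b (dartMat x y) ≠ 0 →
      s(x, y) = s(Sum.inl a, Sum.inr b) :=
    fun x y hxy hne => (rel_of_dartMat_apply_ne_zero hxy (by simpa using hne)).2.1
  obtain ⟨h0, h1⟩ := map_walkSum_of_isTrail (Matrix.entryAddMonoidHom ℤ a b) dartMat he hp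
  have hw : walkSum dartMat p a b = Matrix.entryAddMonoidHom ℤ a b (walkSum dartMat p) := rfl
  by_cases hm : s(Sum.inl a, Sum.inr b) ∈ p.edges
  · obtain ⟨d, hd, hde⟩ := List.mem_map.1 hm
    have hd' : (d.fst = Sum.inl a ∧ d.snd = Sum.inr b) ∨ (d.fst = Sum.inr b ∧ d.snd = Sum.inl a) :=
      Sym2.eq_iff.1 hde
    rw [hw, h1 d hd hde]
    rcases hd' with ⟨h₁, h₂⟩ | ⟨h₁, h₂⟩ <;> simp [h₁, h₂]
  · rw [hw, h0 hm]; simp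

/-- The dart matrix of a non-trivial trail is non-zero. [folklore] -/
theorem walkSum_dartMat_ne_zero {G : α → β → Prop} {u v : α ⊕ β}
    {p : (relGraph G).Walk u v} (hp : p.IsTrail) (hn : ¬ p.Nil) : walkSum dartMat p ≠ 0 := by
  obtain ⟨d, hd⟩ : ∃ d, d ∈ p.darts := by
    cases p with
    | nil => exact absurd Walk.nil_nil hn
    | cons h q => exact ⟨⟨(_, _), h⟩, by rw [Walk.darts_cons]; exact List.mem_cons_self⟩
  obtain ⟨a, b, -, hor⟩ := relGraph_adj_iff.1 d.adj
  have hval : dartMat d.fst d.snd a b = 1 ∨ dartMat d.fst d.snd a b = -1 := by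
    rcases hor with ⟨h₁, h₂⟩ | ⟨h₁, h₂⟩
    · exact Or.inl (by simp [h₁, h₂])
    · exact Or.inr (by simp [h₁, h₂])
  have hedge : d.edge = s(Sum.inl a, Sum.inr b) := by
    show s(d.fst, d.snd) = _
    rcases hor with ⟨h₁, h₂⟩ | ⟨h₁, h₂⟩
    · rw [h₁, h₂]
    · rw [h₁, h₂, Sym2.eq_swap]
  have he : ∀ x y, (relGraph G).Adj x y → Matrix.entryAddMonoidHom ℤ a b (dartMat x y) ≠ 0 →
      s(x, y) = s(Sum.inl a, Sum.inr b) :=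
    fun x y hxy hne => (rel_of_dartMat_apply_ne_zero hxy (by simpa using hne)).2.1
  have h1 := (map_walkSum_of_isTrail (Matrix.entryAddMonoidHom ℤ a b) dartMat he hp).2 d hd hedge
  intro h0
  rw [h0, map_zero, Matrix.entryAddMonoidHom_apply] at h1
  rcases hval with h | h <;> omega

end DartMat

/-! ## §4 Termination criterion: no cycle ⇒ at most one admissible permutation -/

/-- TERMINATION CRITERION: if the relation graph of `G` on `Fin r ⊕ Fin r` has no cycle, then `G`
admits at most one admissible permutation (two perfect matchings differ by alternating cycles).
[cite: FennerGurjarThierauf2016, Section 3] -/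
theorem perm_unique_of_forall_not_isCycle {r : ℕ} (G : Fin r → Fin r → Prop)
    (hG : ∀ (u : Fin r ⊕ Fin r) (c : (relGraph G).Walk u u), ¬ c.IsCycle)
    {σ τ : Equiv.Perm (Fin r)} (hσ : ∀ k, G k (σ k)) (hτ : ∀ k, G k (τ k)) : σ = τ := by
  by_contra hne
  obtain ⟨k₀, hk₀⟩ : ∃ k, σ k ≠ τ k := by
    by_contra! h
    exact hne (Equiv.ext h)
  -- the alternating permutation `ρ = σ⁻¹ τ` and the key identity `σ (ρ^(i+1) k₀) = τ (ρ^i k₀)`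
  have key : ∀ i, σ (((σ⁻¹ * τ) ^ (i + 1)) k₀) = τ (((σ⁻¹ * τ) ^ i) k₀) := fun i => by
    rw [pow_succ', Equiv.Perm.mul_apply, Equiv.Perm.mul_apply, Equiv.Perm.inv_def,
      Equiv.apply_symm_apply]
  -- the first return time `m` of `k₀` under `ρ`
  have hper : ∃ m, 0 < m ∧ ((σ⁻¹ * τ) ^ m) k₀ = k₀ :=
    ⟨orderOf (σ⁻¹ * τ), orderOf_pos _, by rw [pow_orderOf_eq_one, Equiv.Perm.one_apply]⟩
  obtain ⟨m, hm, hmin⟩ : ∃ m, (0 < m ∧ ((σ⁻¹ * τ) ^ m) k₀ = k₀) ∧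
      ∀ j, j < m → ¬ (0 < j ∧ ((σ⁻¹ * τ) ^ j) k₀ = k₀) :=
    ⟨Nat.find hper, Nat.find_spec hper, fun j hj => Nat.find_min hper hj⟩
  -- the `τ`-edges along the orbit avoid the edge `e₀ = inl k₀ — inr (σ k₀)`
  have hτe : ∀ i, i < m → ((relGraph G).deleteEdges {s(Sum.inl k₀, Sum.inr (σ k₀))}).Adj
      (Sum.inl (((σ⁻¹ * τ) ^ i) k₀)) (Sum.inr (τ (((σ⁻¹ * τ) ^ i) k₀))) := by
    intro i hi
    rw [SimpleGraph.deleteEdges_adj, relGraph_adj_inl_inr, Set.mem_singleton_iff, Sym2.eq_iff]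
    refine ⟨hτ _, ?_⟩
    rintro (⟨h₁, h₂⟩ | ⟨h₁, -⟩)
    · have hi0 : ((σ⁻¹ * τ) ^ i) k₀ = k₀ := Sum.inl_injective h₁
      rw [hi0] at h₂
      exact hk₀ (Sum.inr_injective h₂).symm
    · exact Sum.inl_ne_inr h₁
  -- the `σ`-edges at `ρ^j k₀`, `0 < j < m`, avoid `e₀`
  have hσe : ∀ j, 0 < j → j < m → ((relGraph G).deleteEdges {s(Sum.inl k₀, Sum.inr (σ k₀))}).Adj
      (Sum.inr (σ (((σ⁻¹ * τ) ^ j) k₀))) (Sum.inl (((σ⁻¹ * τ) ^ j) k₀)) := by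
    intro j hj hjm
    rw [SimpleGraph.deleteEdges_adj, relGraph_adj_inr_inl, Set.mem_singleton_iff, Sym2.eq_iff]
    refine ⟨hσ _, ?_⟩
    rintro (⟨h₁, -⟩ | ⟨-, h₂⟩)
    · exact Sum.inr_ne_inl h₁
    · exact hmin j hjm ⟨hj, Sum.inl_injective h₂⟩
  have hreach : ∀ i, i < m → ((relGraph G).deleteEdges {s(Sum.inl k₀, Sum.inr (σ k₀))}).Reachable
      (Sum.inl k₀) (Sum.inl (((σ⁻¹ * τ) ^ i) k₀)) := by
    intro i hi
    induction i with
    | zero =>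
      exact ((Walk.nil : ((relGraph G).deleteEdges {s(Sum.inl k₀, Sum.inr (σ k₀))}).Walk
        (Sum.inl k₀) (Sum.inl k₀)).copy rfl (by rw [pow_zero, Equiv.Perm.one_apply])).reachable
    | succ i ih =>
      have h3 := hσe (i + 1) (Nat.succ_pos i) hi
      rw [key i] at h3
      exact ((ih (Nat.lt_of_succ_lt hi)).trans (hτe i (Nat.lt_of_succ_lt hi)).reachable).trans
        h3.reachable
  -- closing up: the `τ`-edge at `ρ^(m-1) k₀` ends in `inr (σ k₀)`
  have hlast : ((relGraph G).deleteEdges {s(Sum.inl k₀, Sum.inr (σ k₀))}).Reachable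
      (Sum.inl k₀) (Sum.inr (σ k₀)) := by
    obtain ⟨m', rfl⟩ : ∃ m', m = m' + 1 := Nat.exists_eq_add_one_of_ne_zero hm.1.ne'
    have h2 := hτe m' (Nat.lt_succ_self m')
    rw [← key m', hm.2] at h2
    exact (hreach m' (Nat.lt_succ_self m')).trans h2.reachable
  have hadj : (relGraph G).Adj (Sum.inl k₀) (Sum.inr (σ k₀)) :=
    (relGraph_adj_inl_inr G _ _).2 (hσ k₀)
  obtain ⟨u, c, hc, -⟩ :=
    SimpleGraph.adj_and_reachable_delete_edges_iff_exists_cycle.1 ⟨hadj, hlast⟩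
  exact hG u c hc

end Summit.ValiantsHypothesis.ValiantsHypothesis.Theorems.RelationGraphCycles
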